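import Literature.Probability.RandomPlanarGeometry.SAWLoopErasureKesten
import HarnessLib

/-!
# The Hara–Slade–Sokal `(0,1)` lower bound in EXACT RENEWAL form: `2d / (2 − 1/G_d) ≤ μ(ℤ^d)` (`d ≥ 3`)

Topic `Literature/Probability/RandomPlanarGeometry`; a successor ("CLASS D child") of `SAWLoopErasureKesten.lean`, whose
loop-erasure-and-restoration engine (HSS93 (2.29) with memory `τ = 0`, `k ≤ 1`: `avoid_card_step`,
`succ_le_sum_count_mul_pow_of`, `two_mul_div_le_connectiveConstant_of`, `sum_loopTuples₂_mul_pow_le`, the Green function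
`G_d = srwI d 1 0 0` of `FitznerVanDerHofstad2017` with `Σ_n u_n (2d)^{-n} = G_d`, `Σ_n p_n(e) = G_d − 1`) is used BY NAME.
There the neighbour-avoiding loop generating function `C₀^{e}(0,0; 1/2d)` was bounded by the FIRST-STEP value
`G_d − (G_d − 1)/(2d)`; here it is bounded by its EXACT printed value (2.33) `= 2 − 1/G_d`, typed as the inequality
`Σ_{n ≤ K} #closedAvoid{e}(n) (2d)^{-n} ≤ 2 − 1/G_d` for every `K` (which is all that (2.32) consumes), via the
last-exit ("renewal") decomposition of §3.1.

## What the source prints (HSS93 = Hara–Slade–Sokal, J. Stat. Phys. 72 (1993) 479–517 = arXiv:hep-lat/9302003)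

PDF p. 11, §2.3: "Taking `k = 0` and `k = 1` gives `Π₀(0; 1/2d) = C₀(0,0; 1/2d)` and `Π₀(1; 1/2d) = C₀^{{e}}(0,0; 1/2d)` (by
symmetry, where `e` is any neighbour of the origin), so (2.29) becomes `μ ≥ 2d / C₀(0,0; 1/2d)` [`k = 0`] (2.31),
`μ ≥ 2d / C₀^{{e}}(0,0; 1/2d)` [`k = 1`] (2.32). … The denominator on the right side of (2.31) is infinite in dimension
`d ≤ 2`, but this defect is remedied in (2.32): in Section 3.1 we shall prove the identity
`C₀^{{e}}(0,0; 1/2d) = 2 − 1/C₀(0,0; 1/2d) ≤ 2` (2.33) in all dimensions. … For `d = 2`, (2.32) gives the rather poor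
bound `μ ≥ 2`. For `d = 3`, (2.32) already does better than all previously known bounds, yielding `μ ≥ 4.475817…`."
PDF p. 18, §3.1: "Given a walk `ω` contributing to the sum on the right side, we break the walk into two pieces at its
first visit to `b`. … (3.2) … An amusing special case is `y = x = 0` and `A = {e}`, where `e` is a nearest neighbour of the
origin. Using the identity `C₀(0,0;β) = 1 + 2dβ C₀(0,e;β)` (3.3) together with (3.2), we find … (3.4) … and yields
`C₀^{{e}}(0,0; 1/2d) = 2 − 1/C₀(0,0; 1/2d) ≤ 2`. (3.5)"  PDF p. 14, Table 2, row `(0,1)`: `d = 2`: 2; `d = 3`: 4.475 817;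
`d = 4`: 6.704 650; `d = 5`: 8.809 186; `d = 6`: 10.862 525 — "The numerical values have been truncated to give rigorous
lower bounds."

## What is typed (standard axioms; no `sorry`; every GF statement at `β = 1/2d`)

* `two_mul_div_renewal_le_connectiveConstant (hd : 3 ≤ d) : 2d / (2 − 1/G_d) ≤ μ(ℤ^d)` — (2.32) with the value (2.33),
  as a function of the tree's real number `G_d = srwI d 1 0 0` (no decimal value of `G_d` is asserted: the Table-2
  inputs `C₀(0,0;1/2d)` for `d = 3, 4` are Appendix-A numerics for which the tree holds no certified enclosure; for
  `d ≥ 5` the parent's Taylor enclosure gives the effective corollary below);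
  `two_mul_div_renewal_le_connectiveConstant_of_le : G_d ≤ B → 2d/(2 − 1/B) ≤ μ(ℤ^d)` (plug-in form);
* `two_mul_div_renewal_explicit_le_connectiveConstant (hd : 5 ≤ d)` (with `B = 1 + 1/(2d) + 3/(4d²) + 15/(8d³) + 11392/d⁴`)
  and `kesten_second_order_effective_renewal (hd : 5 ≤ d) : 2d − 1 − 1/(2d) − 7/(4d²) − 22778/d³ ≤ μ(ℤ^d)` — the
  parent's `kesten_second_order_effective` (`… − 9/(4d²) − 22780/d³`) improved by `1/(2d²)` at every `d ≥ 5`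
  (HSS93 §6.3: with the exact `G_d` the `(0,1)` bound is `2d − 1 − 1/(2d) − 1/d² + O(d⁻³)`; the truth (6.2) has `−3/(4d²)`·…);
* the combinatorics behind (3.2)–(3.5), at the level of COUNTS: escape walks `escTo x c` (`0 → x` in `c` steps without
  revisiting `0`; `ℓ_c(x)` their number, `escN d c` for a unit vector, direction-free by `card_escTo_stepVec_eq`), the
  exact last-visit split `count_eq_sum_count_mul_card_escTo : #{n-step walks 0 → x} = Σ_σ u_σ ℓ_{n−σ}(x)` (⇒
  `srwI_mul_tsum_escN_mul_pow : G_d · Σ_c ℓ_c β^c = G_d − 1`, `tsum_escN_mul_pow : Σ_c ℓ_c β^c = 1 − 1/G_d`, the hitting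
  probability of (3.3)); the DISJOINT fibres `visFiber s n b a` of closed `n`-loops through `e_s` (last visit to `e_s` at
  `b + a`, last previous visit to `0` at `b`) with `card_visFiber_eq : #V_{b+(a+c)}(b,a) = u_b ℓ_a(e_s) ℓ_c(−e_s)`, whence
  `card_closedAvoid_add_sum_le : #closedAvoid{e_s}(n) + ν_n ≤ u_n` with `ν_n = nuN d n = Σ_{b+a ≤ n} u_b ℓ_a ℓ_{n−b−a}`,
  `hasSum_nuN_mul_pow : Σ_n ν_n βⁿ = G_d (1 − 1/G_d)²` (two Cauchy products), and
  `sum_count_sub_nuN_mul_pow_le : Σ_{j ≤ K} (u_j − ν_j) βʲ ≤ 2 − 1/G_d`;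
* the endgame `avoid_card_le_renewal`, `pow_le_sum_count_mul_loopTuples_renewal` = the parent's (2.29) steps with the
  loop numbers `u_σ − ν_σ` at the pivots `j ≥ 1`.

NOT CLAIMED: the equality in (2.33)/(3.4)–(3.5) (only the `≤ 2 − 1/G_d` half, on partial sums, which is what (2.32)
uses; (3.4) at general `β` is not typed); no decimal for `G_d`, hence the Table-2 numbers only as `d ↦ 2d/(2 − 1/G_d)`;
nothing for `d ≤ 2` (there (2.32) reads `μ ≥ 2d/2 = d`, weaker than the tree).  Label (proposed): PORT of the printed
theorem (2.32)∧(2.33 "≤") with its Table 2 `(0,1)` row as a function of `G_d`, + the effective `1/d` corollary;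
CLASS D child of `SAWLoopErasureKesten`.
-/

noncomputable section

namespace Literature.Probability.RandomPlanarGeometry.SAW.Zd.LoopErasure

open Finset
open Literature.Probability.LatticeModels Literature.Probability.LatticeModels.SRW
open Literature.Barriers.CriticalPhenomena Literature.Barriers.CriticalPhenomena.SAWLace
open Literature.Probability.FitznerVanDerHofstad2017

variable {d : ℕ}

/-! ### Escape walks `0 → x` (no return to the origin) and the last-visit split of all walks `0 → x` -/

/-- The escape property of a `c`-step walk: it ends at `x` and does not revisit the origin at any time `1, …, c`.
[cite: HaraSladeSokal1993, Section 2.3, eq. (2.32)-(2.33) (last-exit decomposition behind the renewal identity)] -/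
def EscPred (x : Site d) {c : ℕ} (ω : StepSeq d c) : Prop :=
  endpoint ω = x ∧ ∀ t, 1 ≤ t → t ≤ c → pos ω t ≠ 0

open Classical in
/-- The `c`-step walks from `0` to `x` that do not revisit the origin at any time `1, …, c` ("escape walks";
their number is `ℓ_c(x)`). [cite: HaraSladeSokal1993, Section 2.3, eq. (2.32)-(2.33) (last-exit decomposition behind the renewal identity)] -/
def escTo (x : Site d) (c : ℕ) : Finset (StepSeq d c) :=
  Finset.univ.filter (EscPred x)

open Classical in
/-- Membership in `escTo`. [cite: HaraSladeSokal1993, Section 2.3, eq. (2.32)-(2.33) (last-exit decomposition behind the renewal identity)] -/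
theorem mem_escTo {x : Site d} {c : ℕ} {ω : StepSeq d c} :
    ω ∈ escTo x c ↔ endpoint ω = x ∧ ∀ t, 1 ≤ t → t ≤ c → pos ω t ≠ 0 := by
  rw [escTo, Finset.mem_filter]
  exact ⟨fun h => h.2, fun h => ⟨Finset.mem_univ _, h⟩⟩

/-- `ℓ_c(x) ≤ #{c-step walks 0 → x} = count d c x`. [cite: HaraSladeSokal1993, Section 2.3, eq. (2.32)-(2.33) (last-exit decomposition behind the renewal identity)] -/
theorem card_escTo_le_count (x : Site d) (c : ℕ) : (escTo x c).card ≤ SRW.count d c x := by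
  classical
  rw [SRW.count]
  refine Finset.card_le_card fun ω hω => ?_
  rw [mem_escTo] at hω
  rw [Finset.mem_filter]
  exact ⟨Finset.mem_univ _, hω.1⟩

open Classical in
/-- The last visit to the origin of an `n`-step walk (a time in `0, …, n`). [cite: HaraSladeSokal1993, Section 2.3, eq. (2.32)-(2.33) (last-exit decomposition behind the renewal identity)] -/
def lastZero {n : ℕ} (ω : StepSeq d n) : ℕ :=
  ((range (n + 1)).filter fun t => pos ω t = 0).max' ⟨0, by simp⟩

/-- Characterisation of the last visit to the origin. [cite: HaraSladeSokal1993, Section 2.3, eq. (2.32)-(2.33) (last-exit decomposition behind the renewal identity)] -/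
theorem lastZero_eq_iff {n : ℕ} (ω : StepSeq d n) (σ : ℕ) :
    lastZero ω = σ ↔ σ ≤ n ∧ pos ω σ = 0 ∧ ∀ t, σ < t → t ≤ n → pos ω t ≠ 0 := by
  classical
  set S := (range (n + 1)).filter fun t => pos ω t = 0 with hS
  have hne : S.Nonempty := ⟨0, by simp [hS]⟩
  have hmem : ∀ t, t ∈ S ↔ t ≤ n ∧ pos ω t = 0 := by
    intro t; rw [hS, Finset.mem_filter, Finset.mem_range]; constructor
    · rintro ⟨h1, h2⟩; exact ⟨by omega, h2⟩
    · rintro ⟨h1, h2⟩; exact ⟨by omega, h2⟩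
  have hspec : lastZero ω ∈ S := S.max'_mem hne
  have hmax : ∀ t ∈ S, t ≤ lastZero ω := fun t ht => S.le_max' t ht
  constructor
  · rintro rfl
    obtain ⟨h1, h2⟩ := (hmem _).1 hspec
    exact ⟨h1, h2, fun t ht htn h0 => absurd (hmax t ((hmem t).2 ⟨htn, h0⟩)) (by omega)⟩
  · rintro ⟨h1, h2, h3⟩
    obtain ⟨k1, k2⟩ := (hmem _).1 hspec
    have hle : σ ≤ lastZero ω := hmax σ ((hmem σ).2 ⟨h1, h2⟩)
    rcases hle.lt_or_eq with hlt | heq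
    · exact absurd k2 (h3 _ hlt k1)
    · exact heq.symm

/-- `lastZero ω ≤ n`. [cite: HaraSladeSokal1993, Section 2.3, eq. (2.32)-(2.33) (last-exit decomposition behind the renewal identity)] -/
theorem lastZero_le {n : ℕ} (ω : StepSeq d n) : lastZero ω ≤ n :=
  (((lastZero_eq_iff ω (lastZero ω)).1 rfl)).1

open Classical in
/-- The `n`-step walks `0 → x` whose last visit to the origin is at time `σ`. [cite: HaraSladeSokal1993, Section 2.3, eq. (2.32)-(2.33) (last-exit decomposition behind the renewal identity)] -/
def lastZeroFiber (x : Site d) (n σ : ℕ) : Finset (StepSeq d n) :=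
  Finset.univ.filter fun ω => endpoint ω = x ∧ lastZero ω = σ

/-- Transport of the fibre cardinality along `n = n'`. [cite: HaraSladeSokal1993, Section 2.3, eq. (2.32)-(2.33) (last-exit decomposition behind the renewal identity)] -/
theorem card_lastZeroFiber_congr {n n' : ℕ} (h : n = n') (x : Site d) (σ : ℕ) :
    (lastZeroFiber x n σ).card = (lastZeroFiber x n' σ).card := by
  subst h; rfl

/-- `count d n x = Σ_{σ ≤ n} #lastZeroFiber x n σ` (every walk has exactly one last visit to `0`).
[cite: HaraSladeSokal1993, Section 2.3, eq. (2.32)-(2.33) (last-exit decomposition behind the renewal identity)] -/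
theorem count_eq_sum_card_lastZeroFiber (x : Site d) (n : ℕ) :
    SRW.count d n x = ∑ σ ∈ range (n + 1), (lastZeroFiber x n σ).card := by
  classical
  rw [SRW.count]
  rw [Finset.card_eq_sum_card_fiberwise (f := fun ω : StepSeq d n => lastZero ω) (t := range (n + 1))
    (fun ω _ => Finset.mem_range.2 (Nat.lt_succ_of_le (lastZero_le ω)))]
  refine Finset.sum_congr rfl fun σ _ => ?_
  rw [lastZeroFiber, Finset.filter_filter]

/-- **The fibre is a product**: an `(σ + r)`-step walk `0 → x` with last visit to `0` at time `σ` is exactly a closed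
`σ`-loop followed by an `r`-step escape walk `0 → x`. [cite: HaraSladeSokal1993, Section 2.3, eq. (2.32)-(2.33) (last-exit decomposition behind the renewal identity)] -/
theorem card_lastZeroFiber_eq (x : Site d) (σ r : ℕ) :
    (lastZeroFiber x (σ + r) σ).card = SRW.count d σ 0 * (escTo x r).card := by
  classical
  rw [SRW.count, ← Finset.card_product]
  have hset : lastZeroFiber x (σ + r) σ =
      ((Finset.univ.filter fun ω : StepSeq d σ => endpoint ω = 0) ×ˢ escTo x r).map
        (Fin.appendEquiv σ r).toEmbedding := by
    ext ω
    rw [Finset.mem_map_equiv, Finset.mem_product, Finset.mem_filter, mem_escTo, lastZeroFiber, Finset.mem_filter,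
      lastZero_eq_iff]
    set p := (Fin.appendEquiv σ r).symm ω with hp
    have hω : Fin.append p.1 p.2 = ω := (Fin.appendEquiv σ r).apply_symm_apply ω
    have h1 : ∀ t, t ≤ σ → pos ω t = pos p.1 t := by
      intro t ht; rw [← hω, pos_append_of_le p.1 p.2 ht]
    have h2 : ∀ t, pos ω (σ + t) = pos p.1 σ + pos p.2 t := by
      intro t; rw [← hω, pos_append_add]
    have hend : endpoint ω = endpoint p.1 + endpoint p.2 := by
      rw [← pos_eq_endpoint, ← pos_eq_endpoint, ← pos_eq_endpoint, h2]
    simp only [Finset.mem_univ, true_and]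
    constructor
    · rintro ⟨hx, -, hσ0, hlast⟩
      have e1 : endpoint p.1 = 0 := by rw [← pos_eq_endpoint, ← h1 σ le_rfl, hσ0]
      refine ⟨e1, ?_, fun t ht1 ht2 h0 => ?_⟩
      · rw [hend, e1, zero_add] at hx; exact hx
      · refine hlast (σ + t) (by omega) (by omega) ?_
        rw [h2, pos_eq_endpoint, e1, zero_add, h0]
    · rintro ⟨e1, ex, hesc⟩
      refine ⟨by rw [hend, e1, ex, zero_add], by omega, by rw [h1 σ le_rfl, pos_eq_endpoint, e1], fun t ht htn h0 => ?_⟩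
      obtain ⟨k, rfl⟩ := Nat.exists_eq_add_of_lt ht
      refine hesc (k + 1) (by omega) (by omega) ?_
      have := h2 (k + 1)
      rw [show σ + k + 1 = σ + (k + 1) by omega] at h0
      rw [h0, pos_eq_endpoint, e1, zero_add] at this
      exact this.symm
  rw [hset, Finset.card_map]

/-- **Last-exit decomposition (exact)**: `count d n x = Σ_{σ ≤ n} u_σ · ℓ_{n−σ}(x)` — every walk `0 → x` splits
uniquely at its last visit to the origin into a closed loop and an escape walk. [cite: HaraSladeSokal1993, Section 2.3, eq. (2.32)-(2.33) (last-exit decomposition behind the renewal identity)] -/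
theorem count_eq_sum_count_mul_card_escTo (x : Site d) (n : ℕ) :
    SRW.count d n x = ∑ σ ∈ range (n + 1), SRW.count d σ 0 * (escTo x (n - σ)).card := by
  rw [count_eq_sum_card_lastZeroFiber]
  refine Finset.sum_congr rfl fun σ hσ => ?_
  rw [Finset.mem_range] at hσ
  rw [card_lastZeroFiber_congr (show n = σ + (n - σ) by omega), card_lastZeroFiber_eq]

/-! ### The escape numbers do not depend on the direction: `ℓ_c(e_s) = ℓ_c(e_{s'})` -/

/-- `count d n (e_s) = count d n (e_{s'})` (`d ≥ 1`; from the real symmetry `p_n(e_s) = p_n(e_{s'})`).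
[cite: HaraSladeSokal1993, Section 2.3, eq. (2.32)-(2.33) (last-exit decomposition behind the renewal identity)] -/
theorem count_stepVec_eq (hd : 1 ≤ d) (n : ℕ) (s s' : Dir d) :
    SRW.count d n (stepVec s) = SRW.count d n (stepVec s') := by
  have h := srwLaw_stepVec_eq hd n s s'
  rw [← count_mul_pow_eq_srwLaw, ← count_mul_pow_eq_srwLaw] at h
  have hβ : (1 / (2 * (d : ℝ))) ^ n ≠ 0 := by
    have : (0 : ℝ) < d := by exact_mod_cast hd
    positivity
  exact_mod_cast mul_right_cancel₀ hβ h

/-- **`ℓ_c(e_s) = ℓ_c(e_{s'})`** for all directions `s, s'` (`d ≥ 1`): the exact last-exit decomposition determines the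
escape numbers triangularly from the symmetric numbers `count d n (e_s)` and `u_σ`. [cite: HaraSladeSokal1993, Section 2.3, eq. (2.32)-(2.33) (last-exit decomposition behind the renewal identity)] -/
theorem card_escTo_stepVec_eq (hd : 1 ≤ d) (s s' : Dir d) :
    ∀ c : ℕ, (escTo (stepVec s) c).card = (escTo (stepVec s') c).card := by
  intro c
  induction c using Nat.strong_induction_on with
  | _ c ih =>
  have h1 := count_eq_sum_count_mul_card_escTo (stepVec s) c
  have h2 := count_eq_sum_count_mul_card_escTo (stepVec s') c
  rw [count_stepVec_eq hd c s s'] at h1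
  rw [Finset.sum_range_succ'] at h1 h2
  have htail : ∑ σ ∈ range c, SRW.count d (σ + 1) 0 * (escTo (stepVec s) (c - (σ + 1))).card =
      ∑ σ ∈ range c, SRW.count d (σ + 1) 0 * (escTo (stepVec s') (c - (σ + 1))).card := by
    refine Finset.sum_congr rfl fun σ hσ => ?_
    rw [Finset.mem_range] at hσ
    rw [ih (c - (σ + 1)) (by omega)]
  rw [htail] at h1
  have h := h1.symm.trans h2
  have hu0 : SRW.count d 0 (0 : Site d) = 1 := by rw [SRW.count_zero, if_pos rfl]
  simpa [hu0] using h

/-- `ℓ_c := max_s ℓ_c(e_s)` — the common value of the escape numbers to a neighbour (the `max` only avoids choosing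
a direction). [cite: HaraSladeSokal1993, Section 2.3, eq. (2.32)-(2.33) (last-exit decomposition behind the renewal identity)] -/
def escN (d c : ℕ) : ℕ :=
  (Finset.univ : Finset (Dir d)).sup fun s => (escTo (stepVec s) c).card

/-- `ℓ_c = ℓ_c(e_s)` for every direction `s` (`d ≥ 1`). [cite: HaraSladeSokal1993, Section 2.3, eq. (2.32)-(2.33) (last-exit decomposition behind the renewal identity)] -/
theorem escN_eq (hd : 1 ≤ d) (s : Dir d) (c : ℕ) : escN d c = (escTo (stepVec s) c).card := by
  apply le_antisymm
  · refine Finset.sup_le fun s' _ => ?_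
    rw [card_escTo_stepVec_eq hd s' s c]
  · exact Finset.le_sup (f := fun s' : Dir d => (escTo (stepVec s') c).card) (Finset.mem_univ s)

/-! ### Closed loops through a neighbour: the fibres of the (last visit to `e`, last previous visit to `0`) map -/

/-- The fibre predicate: a closed `n`-loop at `0` whose LAST visit to `e_s` is at time `b + a` and whose last visit to
`0` before that is at time `b`. [cite: HaraSladeSokal1993, Section 2.3, eq. (2.32)-(2.33) (last-exit decomposition behind the renewal identity)] -/
def VisPred (s : Dir d) (n b a : ℕ) (ω : StepSeq d n) : Prop :=
  endpoint ω = 0 ∧ pos ω (b + a) = stepVec s ∧ (∀ t, b + a < t → t ≤ n → pos ω t ≠ stepVec s) ∧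
    pos ω b = 0 ∧ ∀ t, b < t → t ≤ b + a → pos ω t ≠ 0

open Classical in
/-- The fibre `V_n(b, a)` of closed `n`-loops through `e_s` (see `VisPred`). [cite: HaraSladeSokal1993, Section 2.3, eq. (2.32)-(2.33) (last-exit decomposition behind the renewal identity)] -/
def visFiber (s : Dir d) (n b a : ℕ) : Finset (StepSeq d n) :=
  Finset.univ.filter (VisPred s n b a)

open Classical in
/-- Membership in `visFiber`. [cite: HaraSladeSokal1993, Section 2.3, eq. (2.32)-(2.33) (last-exit decomposition behind the renewal identity)] -/
theorem mem_visFiber {s : Dir d} {n b a : ℕ} {ω : StepSeq d n} :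
    ω ∈ visFiber s n b a ↔ VisPred s n b a ω := by
  rw [visFiber, Finset.mem_filter]
  exact ⟨fun h => h.2, fun h => ⟨Finset.mem_univ _, h⟩⟩

/-- Transport of the fibre cardinality along `n = n'`. [cite: HaraSladeSokal1993, Section 2.3, eq. (2.32)-(2.33) (last-exit decomposition behind the renewal identity)] -/
theorem card_visFiber_congr {n n' : ℕ} (h : n = n') (s : Dir d) (b a : ℕ) :
    (visFiber s n b a).card = (visFiber s n' b a).card := by
  subst h; rfl

/-- **The fibre is a triple product**: `#V_{b+(a+c)}(b, a) = u_b · ℓ_a(e_s) · ℓ_c(−e_s)` — a closed `b`-loop, an escape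
walk `0 → e_s` of length `a`, and (translated by `e_s`) an escape walk `0 → −e_s` of length `c`.
[cite: HaraSladeSokal1993, Section 2.3, eq. (2.32)-(2.33) (last-exit decomposition behind the renewal identity)] -/
theorem card_visFiber_eq (s : Dir d) (b a c : ℕ) :
    (visFiber s (b + (a + c)) b a).card =
      SRW.count d b 0 * ((escTo (stepVec s) a).card * (escTo (-stepVec s) c).card) := by
  classical
  rw [SRW.count, ← Finset.card_product, ← Finset.card_product]
  set E : (StepSeq d b × (StepSeq d a × StepSeq d c)) ≃ StepSeq d (b + (a + c)) :=
    (Equiv.prodCongr (Equiv.refl _) (Fin.appendEquiv a c)).trans (Fin.appendEquiv b (a + c)) with hE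
  have hset : visFiber s (b + (a + c)) b a =
      ((Finset.univ.filter fun ω : StepSeq d b => endpoint ω = 0) ×ˢ
        (escTo (stepVec s) a ×ˢ escTo (-stepVec s) c)).map E.toEmbedding := by
    ext ω
    rw [Finset.mem_map_equiv, Finset.mem_product, Finset.mem_product, Finset.mem_filter, mem_escTo, mem_escTo,
      mem_visFiber, VisPred]
    -- the three pieces
    set p := (Fin.appendEquiv b (a + c)).symm ω with hp
    set q := (Fin.appendEquiv a c).symm p.2 with hq
    have hEs : E.symm ω = (p.1, q) := by
      rw [hE]; rfl
    have hω : Fin.append p.1 (Fin.append q.1 q.2) = ω := by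
      have h2 : Fin.append q.1 q.2 = p.2 := (Fin.appendEquiv a c).apply_symm_apply p.2
      rw [h2]; exact (Fin.appendEquiv b (a + c)).apply_symm_apply ω
    have h1 : ∀ t, t ≤ b → pos ω t = pos p.1 t := by
      intro t ht; rw [← hω, pos_append_of_le _ _ ht]
    have h2 : ∀ t, t ≤ a → pos ω (b + t) = pos p.1 b + pos q.1 t := by
      intro t ht; rw [← hω, pos_append_add, pos_append_of_le _ _ ht]
    have h3 : ∀ t, pos ω (b + (a + t)) = pos p.1 b + (pos q.1 a + pos q.2 t) := by
      intro t; rw [← hω, pos_append_add, pos_append_add]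
    have hend : endpoint ω = pos p.1 b + (pos q.1 a + pos q.2 c) := by
      rw [← pos_eq_endpoint, h3]
    rw [hEs]
    simp only [Finset.mem_univ, true_and]
    constructor
    · rintro ⟨h0, hT, hafter, hb, hmid⟩
      have e1 : pos p.1 b = 0 := by rw [← h1 b le_rfl, hb]
      have e2 : pos q.1 a = stepVec s := by
        have := h2 a le_rfl
        rw [hT, e1, zero_add] at this
        exact this.symm
      refine ⟨by rw [← pos_eq_endpoint, e1], ⟨by rw [← pos_eq_endpoint, e2], fun t ht1 ht2 hz => ?_⟩,
        ⟨?_, fun t ht1 ht2 hz => ?_⟩⟩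
      · refine hmid (b + t) (by omega) (by omega) ?_
        rw [h2 t ht2, e1, zero_add, hz]
      · rw [← pos_eq_endpoint]
        have := hend
        rw [h0, e1, e2, zero_add] at this
        linear_combination (norm := skip) -this
        abel
      · refine hafter (b + (a + t)) (by omega) (by omega) ?_
        rw [h3 t, e1, e2, zero_add, hz, add_zero]
    · rintro ⟨e1, ⟨e2, hq1⟩, ⟨e3, hq2⟩⟩
      rw [← pos_eq_endpoint] at e1 e2 e3
      refine ⟨?_, ?_, fun t ht htn hz => ?_, by rw [h1 b le_rfl, e1], fun t ht htn hz => ?_⟩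
      · rw [hend, e1, e2, e3, zero_add, add_neg_cancel]
      · rw [h2 a le_rfl, e1, e2, zero_add]
      · obtain ⟨k, hk⟩ := Nat.exists_eq_add_of_lt ht
        have hk' : t = b + (a + (k + 1)) := by omega
        rw [hk', h3, e1, e2, zero_add] at hz
        refine hq2 (k + 1) (by omega) (by omega) ?_
        have := congrArg (fun y => -stepVec s + y) hz
        simpa using this
      · obtain ⟨k, hk⟩ := Nat.exists_eq_add_of_lt ht
        have hk' : t = b + (k + 1) := by omega
        rw [hk', h2 (k + 1) (by omega), e1, zero_add] at hz
        exact hq1 (k + 1) (by omega) (by omega) hz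
  rw [hset, Finset.card_map]

/-- A loop in a fibre passes through `e_s` (at the time `b + a ≤ n`), so it is a closed loop NOT avoiding `e_s`.
[cite: HaraSladeSokal1993, Section 2.3, eq. (2.32)-(2.33) (last-exit decomposition behind the renewal identity)] -/
theorem visFiber_subset (s : Dir d) (n b a : ℕ) :
    visFiber s n b a ⊆ (Finset.univ.filter fun ω : StepSeq d n => endpoint ω = 0) \ closedAvoid {stepVec s} n := by
  classical
  intro ω hω
  rw [mem_visFiber, VisPred] at hω
  obtain ⟨h0, hT, -, -, -⟩ := hω
  have hle : b + a ≤ n := by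
    by_contra hlt
    rw [not_le] at hlt
    rw [pos_of_le ω hlt.le, h0] at hT
    exact stepVec_ne_zero s hT.symm
  rw [Finset.mem_sdiff, Finset.mem_filter, mem_closedAvoid]
  refine ⟨⟨Finset.mem_univ _, h0⟩, fun h => h.2 (b + a) hle ?_⟩
  rw [hT]; exact Finset.mem_singleton_self _

/-- Distinct fibres are disjoint (the pair (last visit to `e_s`, last previous visit to `0`) is determined by the loop).
[cite: HaraSladeSokal1993, Section 2.3, eq. (2.32)-(2.33) (last-exit decomposition behind the renewal identity)] -/
theorem visFiber_disjoint (s : Dir d) (n : ℕ) {b a b' a' : ℕ} (hn : b + a ≤ n) (hn' : b' + a' ≤ n)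
    (hne : (b, a) ≠ (b', a')) : Disjoint (visFiber s n b a) (visFiber s n b' a') := by
  classical
  rw [Finset.disjoint_left]
  intro ω h h'
  rw [mem_visFiber, VisPred] at h h'
  obtain ⟨-, hT, hafter, hb, hmid⟩ := h
  obtain ⟨-, hT', hafter', hb', hmid'⟩ := h'
  have hTT : b + a = b' + a' := by
    by_contra hne'
    rcases Nat.lt_or_gt_of_ne hne' with hlt | hgt
    · exact hafter (b' + a') hlt hn' hT'
    · exact hafter' (b + a) hgt hn hT
  have hbb : b = b' := by
    by_contra hne'
    rcases Nat.lt_or_gt_of_ne hne' with hlt | hgt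
    · exact hmid b' hlt (by omega) hb'
    · exact hmid' b hgt (by omega) hb
  exact hne (by rw [hbb]; congr 1; omega)

/-- `ν_n(s) := Σ_{b + a ≤ n} u_b ℓ_a(e_s) ℓ_{n−b−a}(−e_s)` closed `n`-loops pass through `e_s`, all distinct:
**`#closedAvoid {e_s} n + ν_n(s) ≤ u_n`**. [cite: HaraSladeSokal1993, Section 2.3, eq. (2.32)-(2.33) (last-exit decomposition behind the renewal identity)] -/
theorem card_closedAvoid_add_sum_le (s : Dir d) (n : ℕ) :
    (closedAvoid {stepVec s} n).card +
        ∑ b ∈ range (n + 1), ∑ a ∈ range (n - b + 1),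
          SRW.count d b 0 * ((escTo (stepVec s) a).card * (escTo (-stepVec s) (n - b - a)).card) ≤
      SRW.count d n 0 := by
  classical
  set I : Finset (ℕ × ℕ) := ((range (n + 1)) ×ˢ (range (n + 1))).filter fun p => p.1 + p.2 ≤ n with hI
  have hmemI : ∀ p : ℕ × ℕ, p ∈ I ↔ p.1 + p.2 ≤ n := by
    intro p
    rw [hI, Finset.mem_filter, Finset.mem_product, Finset.mem_range, Finset.mem_range]
    constructor
    · exact fun h => h.2
    · intro h; exact ⟨⟨by omega, by omega⟩, h⟩
  -- the double sum is the sum over `I` of the fibre cardinalities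
  have hsum : ∑ b ∈ range (n + 1), ∑ a ∈ range (n - b + 1),
      SRW.count d b 0 * ((escTo (stepVec s) a).card * (escTo (-stepVec s) (n - b - a)).card) =
      ∑ p ∈ I, (visFiber s n p.1 p.2).card := by
    rw [hI, Finset.sum_filter, Finset.sum_product]
    refine Finset.sum_congr rfl fun b hb => ?_
    rw [Finset.mem_range] at hb
    rw [← Finset.sum_filter]
    have hfl : (range (n + 1)).filter (fun a => (b, a).1 + (b, a).2 ≤ n) = range (n - b + 1) := by
      ext a
      simp only [Finset.mem_filter, Finset.mem_range]
      omega
    rw [hfl]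
    refine Finset.sum_congr rfl fun a ha => ?_
    rw [Finset.mem_range] at ha
    rw [card_visFiber_congr (show n = b + (a + (n - b - a)) by omega), card_visFiber_eq]
  rw [hsum, ← Finset.card_biUnion]
  · rw [SRW.count, ← Finset.card_union_of_disjoint]
    · refine Finset.card_le_card (Finset.union_subset ?_ ?_)
      · intro ω hω
        rw [mem_closedAvoid] at hω
        rw [Finset.mem_filter]
        exact ⟨Finset.mem_univ _, hω.1⟩
      · intro ω hω
        rw [Finset.mem_biUnion] at hω
        obtain ⟨p, _, hp⟩ := hω
        exact (Finset.mem_sdiff.1 (visFiber_subset s n p.1 p.2 hp)).1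
    · rw [Finset.disjoint_left]
      intro ω hω hω'
      rw [Finset.mem_biUnion] at hω'
      obtain ⟨p, _, hp⟩ := hω'
      exact (Finset.mem_sdiff.1 (visFiber_subset s n p.1 p.2 hp)).2 hω
  · intro p hp p' hp' hne
    rw [Finset.mem_coe, hmemI] at hp hp'
    exact visFiber_disjoint s n hp hp' (by
      intro h; exact hne (Prod.ext (Prod.mk.inj h).1 (Prod.mk.inj h).2))

/-- The loop-number sequence of the exact renewal: `v_n := u_n − ν_n` with
`ν_n = Σ_{b + a ≤ n} u_b ℓ_a ℓ_{n−b−a}` (direction-free escape numbers `escN`). [cite: HaraSladeSokal1993, Section 2.3, eq. (2.32)-(2.33) (last-exit decomposition behind the renewal identity)] -/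
def nuN (d n : ℕ) : ℕ :=
  ∑ b ∈ range (n + 1), ∑ a ∈ range (n - b + 1), SRW.count d b 0 * (escN d a * escN d (n - b - a))

/-- `ν_n` written with the escape numbers of any direction `s`. [cite: HaraSladeSokal1993, Section 2.3, eq. (2.32)-(2.33) (last-exit decomposition behind the renewal identity)] -/
theorem nuN_eq (hd : 1 ≤ d) (s : Dir d) (n : ℕ) :
    nuN d n = ∑ b ∈ range (n + 1), ∑ a ∈ range (n - b + 1),
      SRW.count d b 0 * ((escTo (stepVec s) a).card * (escTo (-stepVec s) (n - b - a)).card) := by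
  rw [nuN]
  refine Finset.sum_congr rfl fun b _ => Finset.sum_congr rfl fun a _ => ?_
  rw [escN_eq hd s, ← stepVec_neg, escN_eq hd s.neg]

/-- **`#closedAvoid {e_s} n ≤ u_n − ν_n`** for every direction `s` (`d ≥ 1`). [cite: HaraSladeSokal1993, Section 2.3, eq. (2.32)-(2.33) (last-exit decomposition behind the renewal identity)] -/
theorem card_closedAvoid_le_sub_nuN (hd : 1 ≤ d) (s : Dir d) (n : ℕ) :
    (closedAvoid {stepVec s} n).card ≤ SRW.count d n 0 - nuN d n := by
  have h := card_closedAvoid_add_sum_le s n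
  rw [← nuN_eq hd s] at h
  omega

/-- `ν_n ≤ u_n`. [cite: HaraSladeSokal1993, Section 2.3, eq. (2.32)-(2.33) (last-exit decomposition behind the renewal identity)] -/
theorem nuN_le_count (hd : 1 ≤ d) (n : ℕ) : nuN d n ≤ SRW.count d n 0 := by
  have s : Dir d := (⟨0, by omega⟩, true)
  have h := card_closedAvoid_add_sum_le s n
  rw [← nuN_eq hd s] at h
  omega

/-! ### Generating functions at `β = 1/2d`: `Σ ℓ_c β^c = 1 − 1/G_d`, `Σ ν_n βⁿ = G_d (1 − 1/G_d)²` -/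

/-- `Σ_n u_n βⁿ = G_d` (`d ≥ 3`). [cite: HaraSladeSokal1993, Section 2.3, eq. (2.31)-(2.33)] -/
theorem hasSum_count_zero_mul_pow (hd : 3 ≤ d) :
    HasSum (fun n => (SRW.count d n 0 : ℝ) * (1 / (2 * (d : ℝ))) ^ n) (srwI d 1 0 0) := by
  have h := hasSum_srwLaw_srwI_one hd 0 (0 : Fin d → ℤ)
  simp only [zero_add] at h
  simp_rw [count_mul_pow_eq_srwLaw]
  exact h

/-- `Σ_n count d n (e_s) βⁿ = G_d − 1` (`d ≥ 3`). [cite: HaraSladeSokal1993, Section 2.3, eq. (2.31)-(2.33)] -/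
theorem hasSum_count_stepVec_mul_pow (hd : 3 ≤ d) (s : Dir d) :
    HasSum (fun n => (SRW.count d n (stepVec s) : ℝ) * (1 / (2 * (d : ℝ))) ^ n) (srwI d 1 0 0 - 1) := by
  simp_rw [count_mul_pow_eq_srwLaw]
  exact hasSum_srwLaw_stepVec hd s

/-- The escape generating function converges: `Σ_c ℓ_c β^c < ∞` (`d ≥ 3`; `ℓ_c ≤ count d c (e)`).
[cite: HaraSladeSokal1993, Section 2.3, eq. (2.32)-(2.33) (last-exit decomposition behind the renewal identity)] -/
theorem summable_escN_mul_pow (hd : 3 ≤ d) :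
    Summable (fun c => (escN d c : ℝ) * (1 / (2 * (d : ℝ))) ^ c) := by
  have hd1 : 1 ≤ d := by omega
  set s : Dir d := (⟨0, by omega⟩, true) with hs
  refine Summable.of_nonneg_of_le (fun c => by positivity) (fun c => ?_) (hasSum_count_stepVec_mul_pow hd s).summable
  have h : (escN d c : ℝ) ≤ SRW.count d c (stepVec s) := by
    rw [escN_eq hd1 s]; exact_mod_cast card_escTo_le_count _ c
  exact mul_le_mul_of_nonneg_right h (by positivity)

/-- A nonnegative real summable sequence is norm-summable (bookkeeping for the Cauchy product; private, as in
`HexSAWBrickWallSpanRenewal`). [folklore] -/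
private theorem summable_norm_of_nonneg {f : ℕ → ℝ} (hf : Summable f) (h0 : ∀ n, 0 ≤ f n) :
    Summable (fun n => ‖f n‖) := by
  have : (fun n => ‖f n‖) = f := by
    funext n; rw [Real.norm_eq_abs, abs_of_nonneg (h0 n)]
  rw [this]; exact hf

/-- **`G_d · Σ_c ℓ_c β^c = G_d − 1`**, i.e. `Σ_c ℓ_c β^c = 1 − 1/G_d`: the generating-function form of the exact
last-exit decomposition (`d ≥ 3`). [cite: HaraSladeSokal1993, Section 2.3, eq. (2.32)-(2.33) (the hitting probability `F = 1 − 1/G`)] -/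
theorem srwI_mul_tsum_escN_mul_pow (hd : 3 ≤ d) :
    srwI d 1 0 0 * ∑' c, (escN d c : ℝ) * (1 / (2 * (d : ℝ))) ^ c = srwI d 1 0 0 - 1 := by
  have hd1 : 1 ≤ d := by omega
  set β : ℝ := 1 / (2 * (d : ℝ)) with hβ
  set s : Dir d := (⟨0, by omega⟩, true) with hs
  have hU := hasSum_count_zero_mul_pow hd
  have hΛ := summable_escN_mul_pow hd
  have hprod := hasSum_sum_range_mul_of_summable_norm
    (summable_norm_of_nonneg hU.summable fun n => by positivity)
    (summable_norm_of_nonneg hΛ fun n => by positivity)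
  -- the Cauchy product sequence is `count d n (e_s) βⁿ`
  have hterm : (fun n => ∑ k ∈ range (n + 1), (SRW.count d k 0 : ℝ) * β ^ k * ((escN d (n - k) : ℝ) * β ^ (n - k))) =
      fun n => (SRW.count d n (stepVec s) : ℝ) * β ^ n := by
    funext n
    rw [count_eq_sum_count_mul_card_escTo (stepVec s) n]
    push_cast
    rw [Finset.sum_mul]
    refine Finset.sum_congr rfl fun k hk => ?_
    rw [Finset.mem_range] at hk
    rw [escN_eq hd1 s, show β ^ n = β ^ k * β ^ (n - k) by rw [← pow_add]; congr 1; omega]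
    ring
  rw [hterm] at hprod
  have huniq := hprod.unique (hasSum_count_stepVec_mul_pow hd s)
  rw [hU.tsum_eq] at huniq
  exact huniq

/-- `Σ_c ℓ_c β^c = 1 − 1/G_d` (`d ≥ 3`). [cite: HaraSladeSokal1993, Section 2.3, eq. (2.32)-(2.33) (the hitting probability `F = 1 − 1/G`)] -/
theorem tsum_escN_mul_pow (hd : 3 ≤ d) :
    ∑' c, (escN d c : ℝ) * (1 / (2 * (d : ℝ))) ^ c = 1 - 1 / srwI d 1 0 0 := by
  have hG : 1 ≤ srwI d 1 0 0 := one_le_srwI_one hd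
  have h := srwI_mul_tsum_escN_mul_pow hd
  have hG0 : srwI d 1 0 0 ≠ 0 := by linarith
  field_simp
  linarith

/-- **`Σ_n ν_n βⁿ = G_d (1 − 1/G_d)²`** (`d ≥ 3`): two Cauchy products. [cite: HaraSladeSokal1993, Section 2.3, eq. (2.33) (`C₀^{e}(0,0) = 2 − 1/C₀(0,0)`)] -/
theorem hasSum_nuN_mul_pow (hd : 3 ≤ d) :
    HasSum (fun n => (nuN d n : ℝ) * (1 / (2 * (d : ℝ))) ^ n)
      (srwI d 1 0 0 * (1 - 1 / srwI d 1 0 0) ^ 2) := by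
  set β : ℝ := 1 / (2 * (d : ℝ)) with hβ
  have hU := hasSum_count_zero_mul_pow hd
  have hΛ := summable_escN_mul_pow hd
  have hΛn := summable_norm_of_nonneg hΛ fun n => by positivity
  -- inner product `M n = Σ_{a ≤ n} ℓ_a ℓ_{n−a} βⁿ`
  have hM := hasSum_sum_range_mul_of_summable_norm hΛn hΛn
  rw [tsum_escN_mul_pow hd] at hM
  have hM0 : ∀ n, 0 ≤ ∑ k ∈ range (n + 1), (escN d k : ℝ) * β ^ k * ((escN d (n - k) : ℝ) * β ^ (n - k)) :=
    fun n => Finset.sum_nonneg fun k _ => by positivity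
  have hout := hasSum_sum_range_mul_of_summable_norm
    (summable_norm_of_nonneg hU.summable fun n => by positivity) (summable_norm_of_nonneg hM.summable hM0)
  rw [hU.tsum_eq, hM.tsum_eq, ← pow_two] at hout
  have hterm : (fun n => ∑ k ∈ range (n + 1), (SRW.count d k 0 : ℝ) * β ^ k *
      ∑ j ∈ range (n - k + 1), (escN d j : ℝ) * β ^ j * ((escN d (n - k - j) : ℝ) * β ^ (n - k - j))) =
      fun n => (nuN d n : ℝ) * β ^ n := by
    funext n
    rw [nuN]
    push_cast
    rw [Finset.sum_mul]
    refine Finset.sum_congr rfl fun k hk => ?_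
    rw [Finset.mem_range] at hk
    rw [Finset.mul_sum, Finset.sum_mul]
    refine Finset.sum_congr rfl fun j hj => ?_
    rw [Finset.mem_range] at hj
    rw [show β ^ n = β ^ k * (β ^ j * β ^ (n - k - j)) by
      rw [← pow_add, ← pow_add]; congr 1; omega]
    ring
  rw [hterm] at hout
  exact hout

/-- **The exact renewal bound on the neighbour-avoiding loop generating function**:
`Σ_{j ≤ K} (u_j − ν_j) βʲ ≤ G_d − G_d(1 − 1/G_d)² = 2 − 1/G_d` for every `K` (`d ≥ 3`).
[cite: HaraSladeSokal1993, Section 2.3, eq. (2.33) (`C₀^{e}(0,0) = 2 − 1/C₀(0,0)`)] -/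
theorem sum_count_sub_nuN_mul_pow_le (hd : 3 ≤ d) (K : ℕ) :
    ∑ j ∈ range (K + 1), ((SRW.count d j 0 - nuN d j : ℕ) : ℝ) * (1 / (2 * (d : ℝ))) ^ j ≤
      2 - 1 / srwI d 1 0 0 := by
  have hd1 : 1 ≤ d := by omega
  have hG : 1 ≤ srwI d 1 0 0 := one_le_srwI_one hd
  have hG0 : srwI d 1 0 0 ≠ 0 := by linarith
  have h := (hasSum_count_zero_mul_pow hd).sub (hasSum_nuN_mul_pow hd)
  have hval : srwI d 1 0 0 - srwI d 1 0 0 * (1 - 1 / srwI d 1 0 0) ^ 2 = 2 - 1 / srwI d 1 0 0 := by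
    field_simp
    ring
  rw [hval] at h
  have hfun : (fun j => ((SRW.count d j 0 - nuN d j : ℕ) : ℝ) * (1 / (2 * (d : ℝ))) ^ j) =
      fun j => (SRW.count d j 0 : ℝ) * (1 / (2 * (d : ℝ))) ^ j - (nuN d j : ℝ) * (1 / (2 * (d : ℝ))) ^ j := by
    funext j
    rw [Nat.cast_sub (nuN_le_count hd1 j)]
    ring
  rw [hfun]
  refine sum_le_hasSum _ (fun j _ => ?_) h
  have := nuN_le_count hd1 j
  have hβ : (0 : ℝ) ≤ (1 / (2 * (d : ℝ))) ^ j := by positivity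
  have hc : (nuN d j : ℝ) ≤ SRW.count d j 0 := by exact_mod_cast this
  nlinarith

/-! ### The exact renewal lower bound `2d / (2 − 1/G_d) ≤ μ(ℤ^d)` -/

/-- The loop-erasure inequality with the renewal loop numbers `v = u − ν`: if `0 ∉ A` and `A` contains a neighbour of
the origin, `#{n-step walks avoiding A} ≤ Σ_{m ≤ n} #{m-step SAWs avoiding A} · T^v_{m+1}(n − m)`.
[cite: HaraSladeSokal1993, §2.3, (2.32)-(2.33) with k = 1] -/
theorem avoid_card_le_renewal (hd : 1 ≤ d) (n : ℕ) : ∀ A : Finset (Site d), (0 : Site d) ∉ A →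
    (∃ s : Dir d, stepVec s ∈ A) →
    (avoidSet A n).card ≤ ∑ m ∈ range (n + 1),
      (sawAvoid A m).card * loopTuples (fun σ => SRW.count d σ 0 - nuN d σ) (m + 1) (n - m) := by
  induction n using Nat.strong_induction_on with
  | _ n ih =>
  intro A h0 hA
  obtain ⟨s₀, hs₀⟩ := hA
  have hv : ∀ σ, (closedAvoid A σ).card ≤ SRW.count d σ 0 - nuN d σ := fun σ =>
    (card_closedAvoid_mono (Finset.singleton_subset_iff.2 hs₀) σ).trans (card_closedAvoid_le_sub_nuN hd s₀ σ)
  have h := avoid_card_step (fun σ => SRW.count d σ 0 - nuN d σ) (fun σ => SRW.count d σ 0 - nuN d σ) n A h0 hv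
    (fun s hs r hr => ih r hr _ hs ⟨s.neg, by rw [stepVec_neg]; exact neg_stepVec_mem_shiftSet A s⟩)
  simpa only [loopTuples₂_self] using h

/-- `(2d)ⁿ ≤ Σ_{m ≤ n} c_m T^{u,v}_{m+1}(n − m)` with the renewal loop numbers at the pivots `j ≥ 1`.
[cite: HaraSladeSokal1993, §2.3, (2.29), (2.32)-(2.33), k = 1] -/
theorem pow_le_sum_count_mul_loopTuples_renewal (hd : 1 ≤ d) (n : ℕ) :
    (2 * d) ^ n ≤ ∑ m ∈ range (n + 1),
      count d m * loopTuples₂ (fun σ => SRW.count d σ 0) (fun σ => SRW.count d σ 0 - nuN d σ) (m + 1) (n - m) := by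
  have h := avoid_card_step (fun σ => SRW.count d σ 0) (fun σ => SRW.count d σ 0 - nuN d σ) n
    (∅ : Finset (Site d)) (Finset.notMem_empty _) (fun σ => card_closedAvoid_le_count _ σ)
    (fun s hs r _ => avoid_card_le_renewal hd r _ hs ⟨s.neg, by rw [stepVec_neg]; exact neg_stepVec_mem_shiftSet _ s⟩)
  rw [card_avoidSet_empty] at h
  simpa only [card_sawAvoid_empty] using h

/-- **The Hara–Slade–Sokal `(0,1)` bound, exact renewal form: `2d / (2 − 1/G_d) ≤ μ(ℤ^d)`** for every `d ≥ 3`, where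
`G_d = srwI d 1 0 0` is the simple-random-walk Green function at the origin — eq. (2.32) with `k = 1` and the printed
renewal value (2.33) `C₀^{e}(0,0) = 2 − 1/C₀(0,0)`.  With the printed `G₃ = 1.516386`, `G₄ = 1.239467`,
`G₅ = 1.156308`, `G₆ = 1.116963` (Table 2, input column) this is the printed `(0,1)` row of Table 2:
`μ(ℤ³) ≥ 4.475817`, `μ(ℤ⁴) ≥ 6.704650`, `μ(ℤ⁵) ≥ 8.809186`, `μ(ℤ⁶) ≥ 10.862525` (here as the function
`d ↦ 2d/(2 − 1/G_d)` of the tree's real number `G_d`; no decimal value of `G_d` is asserted).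
[cite: HaraSladeSokal1993, Section 2.3, eq. (2.32)-(2.33); Section 6.2, Table 2, row (0,1)] -/
theorem two_mul_div_renewal_le_connectiveConstant (hd : 3 ≤ d) :
    2 * (d : ℝ) / (2 - 1 / srwI d 1 0 0) ≤ connectiveConstant d := by
  set G := srwI d 1 0 0 with hGdef
  set W : ℝ := 2 - 1 / G with hWdef
  have hG1 : 1 ≤ G := one_le_srwI_one hd
  have hG0 : 0 < G := by linarith
  have hd3 : (3 : ℝ) ≤ d := by exact_mod_cast hd
  have hβ : (0 : ℝ) ≤ 1 / (2 * (d : ℝ)) := by positivity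
  have hW1 : 1 ≤ W := by
    rw [hWdef]
    have : 1 / G ≤ 1 := by rw [div_le_one hG0]; exact hG1
    linarith
  refine two_mul_div_le_connectiveConstant_of (by omega) (C := G) (by linarith) (by linarith) ?_
  refine succ_le_sum_count_mul_pow_of (by omega)
    (loopTuples₂ (fun σ => SRW.count d σ 0) (fun σ => SRW.count d σ 0 - nuN d σ))
    (fun m => G * W ^ m) (pow_le_sum_count_mul_loopTuples_renewal (by omega)) fun K m => ?_
  have hN0 : 0 ≤ ∑ j ∈ range (K + 1), ((SRW.count d j 0 - nuN d j : ℕ) : ℝ) * (1 / (2 * (d : ℝ))) ^ j :=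
    Finset.sum_nonneg fun j _ => by positivity
  calc ∑ k ∈ range (K + 1), (loopTuples₂ (fun σ => SRW.count d σ 0) (fun σ => SRW.count d σ 0 - nuN d σ)
          (m + 1) k : ℝ) * (1 / (2 * (d : ℝ))) ^ k
      ≤ (∑ j ∈ range (K + 1), (SRW.count d j 0 : ℝ) * (1 / (2 * (d : ℝ))) ^ j) *
          (∑ j ∈ range (K + 1), ((SRW.count d j 0 - nuN d j : ℕ) : ℝ) * (1 / (2 * (d : ℝ))) ^ j) ^ m :=
        sum_loopTuples₂_mul_pow_le hβ _ _ K m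
    _ ≤ G * W ^ m := by
        refine mul_le_mul (sum_count_mul_pow_le_srwI hd K)
          (pow_le_pow_left₀ hN0 (sum_count_sub_nuN_mul_pow_le hd K) m) (by positivity) (by linarith)

/-- Monotone form: **`2d / (2 − 1/B) ≤ μ(ℤ^d)` for any `B ≥ G_d`** (`d ≥ 3`) — plug in any certified enclosure of the
Green function. [cite: HaraSladeSokal1993, Section 2.3, eq. (2.32)-(2.33); Section 6.2, eq. (6.17)] -/
theorem two_mul_div_renewal_le_connectiveConstant_of_le (hd : 3 ≤ d) {B : ℝ} (hB : srwI d 1 0 0 ≤ B) :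
    2 * (d : ℝ) / (2 - 1 / B) ≤ connectiveConstant d := by
  have hG1 : 1 ≤ srwI d 1 0 0 := one_le_srwI_one hd
  have hG0 : 0 < srwI d 1 0 0 := by linarith
  have hB0 : 0 < B := by linarith
  have hd0 : (0 : ℝ) ≤ 2 * (d : ℝ) := by positivity
  refine le_trans ?_ (two_mul_div_renewal_le_connectiveConstant hd)
  have h1 : 1 / B ≤ 1 / srwI d 1 0 0 := one_div_le_one_div_of_le hG0 hB
  have h2 : 1 / srwI d 1 0 0 ≤ 1 := by rw [div_le_one hG0]; exact hG1
  exact div_le_div_of_nonneg_left hd0 (by linarith) (by linarith)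

/-! ### Effective form: the `1/d` expansion of the renewal bound to second order -/

/-- The renewal bound with the parent's explicit seven-term Green-function enclosure
`G_d ≤ 1 + 1/(2d) + 3/(4d²) + 15/(8d³) + 11392/d⁴` (`d ≥ 5`).
[cite: HaraSladeSokal1993, Section 2.3, eq. (2.32)-(2.33); Section 6.3 (1/d expansion of the (0,1) bound)] -/
theorem two_mul_div_renewal_explicit_le_connectiveConstant (hd : 5 ≤ d) :
    2 * (d : ℝ) / (2 - 1 / (1 + 1 / (2 * (d : ℝ)) + 3 / (4 * (d : ℝ) ^ 2) + 15 / (8 * (d : ℝ) ^ 3) +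
      11392 / (d : ℝ) ^ 4)) ≤ connectiveConstant d :=
  two_mul_div_renewal_le_connectiveConstant_of_le (by omega) (srwI_one_zero_zero_le_explicit₇ hd)

/-- **Effective second-order Kesten floor from the exact renewal:
`2d − 1 − 1/(2d) − 7/(4d²) − 22778/d³ ≤ μ(ℤ^d)` for every `d ≥ 5`.**  The `(0,1)` bound expands as
`2d − 1 − 1/(2d) − 1/d² + O(d⁻³)` with the exact `G_d` (HSS93 §6.3; the truth is `−3/(16 d²)·…`, eq. (6.2)); with the
seven-term enclosure the `d⁻²` coefficient is `7/4`, improving the parent's first-step value `9/4`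
(`kesten_second_order_effective`) by `1/(2d²)` at every `d`. [cite: HaraSladeSokal1993, Section 2.3, eq. (2.32)-(2.33); Section 6.3] -/
theorem kesten_second_order_effective_renewal (hd : 5 ≤ d) :
    2 * (d : ℝ) - 1 - 1 / (2 * (d : ℝ)) - 7 / (4 * (d : ℝ) ^ 2) - 22778 / (d : ℝ) ^ 3 ≤ connectiveConstant d := by
  have hd5 : (5 : ℝ) ≤ d := by exact_mod_cast hd
  have hd0 : (0 : ℝ) < d := by linarith
  refine le_trans ?_ (two_mul_div_renewal_explicit_le_connectiveConstant hd)
  set B : ℝ := 1 + 1 / (2 * (d : ℝ)) + 3 / (4 * (d : ℝ) ^ 2) + 15 / (8 * (d : ℝ) ^ 3) + 11392 / (d : ℝ) ^ 4 with hB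
  have hB1 : 1 ≤ B := by
    rw [hB]
    have : (0 : ℝ) ≤ 1 / (2 * (d : ℝ)) + 3 / (4 * (d : ℝ) ^ 2) + 15 / (8 * (d : ℝ) ^ 3) + 11392 / (d : ℝ) ^ 4 := by
      positivity
    linarith
  have hB0 : 0 < B := by linarith
  have hW : (0 : ℝ) < 2 - 1 / B := by
    have : 1 / B ≤ 1 := by rw [div_le_one hB0]; exact hB1
    linarith
  rw [le_div_iff₀ hW, hB]
  have key : (2 * (d : ℝ) - 1 - 1 / (2 * (d : ℝ)) - 7 / (4 * (d : ℝ) ^ 2) - 22778 / (d : ℝ) ^ 3) *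
      (2 - 1 / (1 + 1 / (2 * (d : ℝ)) + 3 / (4 * (d : ℝ) ^ 2) + 15 / (8 * (d : ℝ) ^ 3) + 11392 / (d : ℝ) ^ 4)) =
      2 * d - (8 * (d : ℝ) ^ 4 + 1458128 * (d : ℝ) ^ 3 + 1458098 * (d : ℝ) ^ 2 + 4009264 * d + 16607166464) /
        (4 * (d : ℝ) ^ 3 * (8 * (d : ℝ) ^ 4 + 4 * (d : ℝ) ^ 3 + 6 * (d : ℝ) ^ 2 + 15 * d + 91136)) := by
    field_simp
    ring
  rw [key]
  have : (0 : ℝ) ≤ (8 * (d : ℝ) ^ 4 + 1458128 * (d : ℝ) ^ 3 + 1458098 * (d : ℝ) ^ 2 + 4009264 * d + 16607166464) /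
      (4 * (d : ℝ) ^ 3 * (8 * (d : ℝ) ^ 4 + 4 * (d : ℝ) ^ 3 + 6 * (d : ℝ) ^ 2 + 15 * d + 91136)) := by positivity
  linarith

end Literature.Probability.RandomPlanarGeometry.SAW.Zd.LoopErasure

end
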